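import Mathlib
import HarnessLib
import Summits.HubbardSuperconductivity.HubbardSuperconductivity.Theorems.KLProgrammeKLRegimeVolumeLimitV11HE1OfTopFrameTower
import Summits.HubbardSuperconductivity.HubbardSuperconductivity.Theorems.KLProgrammeKLRegimeVolumeLimitV11TowerDataWOfHE1Free

/-!
# Route `KLProgramme` — crux K3, VL child (stmt-HubbardSuperconductivity-20440), (R265) candidate v12W-4: the package-free atom `HE1free` REDUCED TO THE
# EVEN-DEGREE, `S₀`-FREE top-frame tower export `HtopEvenFree` (twin of p3 g19's `he1_of_topFrameTowerEven` for the package-free text)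

Cell `gate-hubbard-kl`, seat p3 (g19).  (R265) adopted (G2′): the VL image's open stubs are the producer and `stub_vl_HE1free` = the binder `HE1free` of
k3c4-p1 g18's `stub_vl_towerDataW_WF2_of_HE1free` (no `TowerP`, E1 names its own budget package `Q₁`).  As for HE1 (p660453), the odd degrees vanish by
parity (`klWtPinnedSumAt_klEffectiveAction_eq_zero_of_odd`) and degree `0` has no pin, so E1's deliverable is the even-degree law alone:

* **`he1free_of_topFrameTowerEvenFree`** — `HtopEvenFree → HE1free`, where `HtopEvenFree` := `∀ P R, P.WF → R.WF2 → ∃ Q₁ (0 ≤ Q₁.CE), ∃ C₀ ≥ 0, ∃ c₇ > 0, …,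
  ∀ μ U β (doors, regime) → ∃ L₂ M₂, ∀ L M ≥ …, (∀ k ≤ n_β, Z_{k+1}[K_top] ≠ 0) ∧ (∀ j ≤ n_β, ∀ p ≥ 1, ∀ q w,
  klWtPinnedSumAt … K_top j j (2p) (𝒱_{j+1}[K_top]) q w ≤ C₀·klWtBudget P Q₁ U (j+1) (2p))` — E1's measured weighted sizes of the one-shot top-frame tower in law
  units at its own package, even degrees only;
* **`stub_vl_towerDataW_WF2_of_HtopEvenFree`** — the v12W-4 data stub's conclusion from `HtopEvenFree ⊕ producer` (one `exact` into k3c4-p1's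
  `stub_vl_towerDataW_WF2_of_HE1free`).

Proofs only; no definition; nothing asserts HE1free, HtopEvenFree, the producer, any stub, K3, VL or superconductivity.  [cite: BenfattoGiulianiMastropietro2006, §2.8 (2.83), §3]
-/

noncomputable section

namespace Summit.HubbardSuperconductivity.HubbardSuperconductivity.Theorems.TwoVolumeSource

set_option linter.dupNamespace false -- summit = problem name (single-conjunct summit), D-0017

open Finset Filter Topology Literature.MathematicalPhysics.QuantumLattice GrassmannAlgebra Literature.Probability.LatticeModels
  Literature.Probability.LatticeModels.BattleFederbush
open Summit.HubbardSuperconductivity.HubbardSuperconductivity.Theorems.TwoPointAssembly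
open Summit.HubbardSuperconductivity.HubbardSuperconductivity.Theorems.KLRegimeSplit
open Summit.HubbardSuperconductivity.HubbardSuperconductivity.Theorems.KLProgrammeLegKernels
open Summit.HubbardSuperconductivity.HubbardSuperconductivity.Theorems.EngineV8
open Summit.HubbardSuperconductivity.HubbardSuperconductivity.Theorems.TwoVolumeDefect
open Summit.HubbardSuperconductivity.HubbardSuperconductivity.Theorems.TorusFourierL2

set_option maxHeartbeats 1600000 in -- long binders
/-- **`HtopEvenFree → HE1free`**: `S₀ j m := C₀·klWtBudget P Q₁ U (j+1) m` at even `m`, `0` at odd `m` (parity); degree `0` has no pin.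
[cite: BenfattoGiulianiMastropietro2006, §2.8 (2.83)] -/
theorem he1free_of_topFrameTowerEvenFree
    (HtopEvenFree : ∀ (P : SplitConsts) (R : RenConsts), P.WF → R.WF2 →
  ∃ Q₁ : EngConsts, 0 ≤ Q₁.CE ∧ ∃ C₀ : ℝ, 0 ≤ C₀ ∧
    ∃ c₇ : ℝ, 0 < c₇ ∧ ∀ c : ℝ, 0 < c → c ≤ c₇ → ∃ U₇ : ℝ, 0 < U₇ ∧
      ∀ μ ∈ klWindowC, ∀ U : ℝ, 0 < U → U ≤ U₇ → ∀ β : ℝ, klBetaMin ≤ β → β ≤ Real.exp (c / U ^ 2) →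
        ∃ L₂ : ℕ, ∃ M₂ : ℕ → ℕ, ∀ (L M : ℕ) [NeZero L] [NeZero M], L₂ ≤ L → M₂ L ≤ M →
          (∀ k, k ≤ nScales β → hubbardEffPartitionFnCT L M β U μ 0 (klFlowFrameU L M β U μ (nScales β + 1)) (klScale klE0 (k + 1)) ≠ 0) ∧
          (∀ j, j ≤ nScales β → ∀ p : ℕ, 1 ≤ p → ∀ (q : Fin (2 * p)) (w : SpaceTimeIdx L M × SectorLeg (sectorCount j)),
            klWtPinnedSumAt L M β μ (klFlowFrameU L M β U μ (nScales β + 1)) j j (2 * p)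
              (klEffectiveAction L M β U μ (klFlowFrameU L M β U μ (nScales β + 1)) klE0 (j + 1)) q w ≤ C₀ * klWtBudget P Q₁ U (j + 1) (2 * p)))
    (P : SplitConsts) (R : RenConsts) (hP : P.WF) (hR2 : R.WF2) :
  ∃ Q₁ : EngConsts, 0 ≤ Q₁.CE ∧ ∃ C₀ : ℝ, 0 ≤ C₀ ∧
    ∃ c₇ : ℝ, 0 < c₇ ∧ ∀ c : ℝ, 0 < c → c ≤ c₇ → ∃ U₇ : ℝ, 0 < U₇ ∧
      ∀ μ ∈ klWindowC, ∀ U : ℝ, 0 < U → U ≤ U₇ → ∀ β : ℝ, klBetaMin ≤ β → β ≤ Real.exp (c / U ^ 2) →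
        ∃ S₀ : ℕ → ℕ → ℝ, (∀ j m, 0 ≤ S₀ j m) ∧ (∀ j, j ≤ nScales β → ∀ m, 1 ≤ m → S₀ j (2 * m) ≤ C₀ * klWtBudget P Q₁ U (j + 1) (2 * m)) ∧
        ∃ L₂ : ℕ, ∃ M₂ : ℕ → ℕ, ∀ (L M : ℕ) [NeZero L] [NeZero M], L₂ ≤ L → M₂ L ≤ M →
          (∀ k, k ≤ nScales β → hubbardEffPartitionFnCT L M β U μ 0 (klFlowFrameU L M β U μ (nScales β + 1)) (klScale klE0 (k + 1)) ≠ 0) ∧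
          (∀ j, j ≤ nScales β → ∀ (m : ℕ) (q : Fin m) (w : SpaceTimeIdx L M × SectorLeg (sectorCount j)),
            klWtPinnedSumAt L M β μ (klFlowFrameU L M β U μ (nScales β + 1)) j j m (klEffectiveAction L M β U μ (klFlowFrameU L M β U μ (nScales β + 1)) klE0 (j + 1)) q w ≤ S₀ j m) := by
  classical
  obtain ⟨Q₁, hCE, C₀, hC₀, c₇, hc₇, h⟩ := HtopEvenFree P R hP hR2
  have hKl : 0 ≤ P.Klam := le_trans zero_le_one hP.1
  refine ⟨Q₁, hCE, C₀, hC₀, c₇, hc₇, fun c hc hcc => ?_⟩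
  obtain ⟨U₇, hU₇, h'⟩ := h c hc hcc
  refine ⟨U₇, hU₇, fun μ hμ U hU hUU β hβmin hβc => ?_⟩
  have hβ0 : β ≠ 0 := (KLRegimeSplit.pos_of_klBetaMin_le hβmin).ne'
  obtain ⟨L₂, M₂, hI⟩ := h' μ hμ U hU hUU β hβmin hβc
  refine ⟨fun j m => if Even m then C₀ * klWtBudget P Q₁ U (j + 1) m else 0, fun j m => ?_, fun j _ m _ => ?_, L₂, M₂,
    fun L M _ _ hL hM => ?_⟩
  · show 0 ≤ (if Even m then C₀ * klWtBudget P Q₁ U (j + 1) m else 0)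
    split_ifs
    · exact mul_nonneg hC₀ (klWtBudget_nonneg hCE hKl U (j + 1) m)
    · exact le_rfl
  · show (if Even (2 * m) then C₀ * klWtBudget P Q₁ U (j + 1) (2 * m) else 0) ≤ C₀ * klWtBudget P Q₁ U (j + 1) (2 * m)
    rw [if_pos (even_two_mul m)]
  · obtain ⟨hZ, hread⟩ := hI L M hL hM
    refine ⟨hZ, fun j hj m q w => ?_⟩
    show _ ≤ (if Even m then C₀ * klWtBudget P Q₁ U (j + 1) m else 0)
    rcases Nat.even_or_odd m with he | ho
    · rw [if_pos he]
      obtain ⟨p, hp⟩ := he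
      rcases Nat.eq_zero_or_pos p with hp0 | hp0
      · subst hp; rw [hp0] at q; exact q.elim0
      · have hm2 : m = 2 * p := by rw [hp]; ring
        subst hm2
        exact hread j hj p hp0 q w
    · rw [if_neg (Nat.not_even_iff_odd.2 ho), klWtPinnedSumAt_klEffectiveAction_eq_zero_of_odd hβ0 U μ _ j j (j + 1) ho q w]

set_option maxHeartbeats 1600000 in -- long binders
/-- **The v12W-4 data stub from `HtopEvenFree` and the producer** (one `exact` into k3c4-p1 g18's `stub_vl_towerDataW_WF2_of_HE1free`).
[folklore: composition; cite: BenfattoGiulianiMastropietro2006, §2.7-§2.9 and §3] -/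
theorem stub_vl_towerDataW_WF2_of_HtopEvenFree
    (HtopEvenFree : ∀ (P : SplitConsts) (R : RenConsts), P.WF → R.WF2 →
  ∃ Q₁ : EngConsts, 0 ≤ Q₁.CE ∧ ∃ C₀ : ℝ, 0 ≤ C₀ ∧
    ∃ c₇ : ℝ, 0 < c₇ ∧ ∀ c : ℝ, 0 < c → c ≤ c₇ → ∃ U₇ : ℝ, 0 < U₇ ∧
      ∀ μ ∈ klWindowC, ∀ U : ℝ, 0 < U → U ≤ U₇ → ∀ β : ℝ, klBetaMin ≤ β → β ≤ Real.exp (c / U ^ 2) →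
        ∃ L₂ : ℕ, ∃ M₂ : ℕ → ℕ, ∀ (L M : ℕ) [NeZero L] [NeZero M], L₂ ≤ L → M₂ L ≤ M →
          (∀ k, k ≤ nScales β → hubbardEffPartitionFnCT L M β U μ 0 (klFlowFrameU L M β U μ (nScales β + 1)) (klScale klE0 (k + 1)) ≠ 0) ∧
          (∀ j, j ≤ nScales β → ∀ p : ℕ, 1 ≤ p → ∀ (q : Fin (2 * p)) (w : SpaceTimeIdx L M × SectorLeg (sectorCount j)),
            klWtPinnedSumAt L M β μ (klFlowFrameU L M β U μ (nScales β + 1)) j j (2 * p)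
              (klEffectiveAction L M β U μ (klFlowFrameU L M β U μ (nScales β + 1)) klE0 (j + 1)) q w ≤ C₀ * klWtBudget P Q₁ U (j + 1) (2 * p)))
    (hSrc : ∀ (P : SplitConsts) (R : RenConsts), P.WF → R.WF2 →
      ∃ Q' : EngConsts, 0 ≤ Q'.CE ∧ ∃ c₀ : ℝ, 0 < c₀ ∧ ∀ c : ℝ, 0 < c → c ≤ c₀ → ∃ U₀ : ℝ, 0 < U₀ ∧
        ∀ μ ∈ klWindowC, ∀ U : ℝ, 0 < U → U ≤ U₀ → ∀ β : ℝ, klBetaMin ≤ β → β ≤ Real.exp (c / U ^ 2) →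
          ∃ A : ℕ → ℕ → ℝ, ∃ L₁ : ℕ, ∃ M₁ : ℕ → ℕ, ∀ (L M : ℕ) [NeZero L] [NeZero M], L₁ ≤ L → M₁ L ≤ M →
            ∀ j : ℕ, j + 1 ≤ nScales β + 1 →
              SourceProfilesAtLev L M (klSrcBudget P Q' U A (j + 1)) β U μ (klFlowFrameU L M β U μ (nScales β + 1)) j j (j + 1))
    (G : GeoConsts) (P : SplitConsts) (Q : EngConsts) (R : RenConsts) (hG : G.WF) (hP : P.WF) (hQ : Q.WF) (hR2 : R.WF2) :
    ∃ c₅ : ℝ, 0 < c₅ ∧ ∀ c : ℝ, 0 < c → c ≤ c₅ → ∃ U₀ : ℝ, 0 < U₀ ∧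
      ∀ μ ∈ klWindowC, ∀ U : ℝ, 0 < U → U ≤ U₀ → ∀ β : ℝ, klBetaMin ≤ β → β ≤ Real.exp (c / U ^ 2) →
        ∀ K : TrigPolyC4v, klPredsV17F2.frameOK R U (nScales β) μ K →
          ∀ (Lstar : ℕ) (Mstar : ℕ → ℕ), TowerP klPredsV17F2 G P Q R β U μ K Lstar Mstar →
            ∃ t : ℝ, 0 < t ∧ t ≤ 1 ∧ Nonempty (TowerDataTSW β U μ t) :=
  stub_vl_towerDataW_WF2_of_HE1free (fun P R hP hR2 => he1free_of_topFrameTowerEvenFree HtopEvenFree P R hP hR2) hSrc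
    G P Q R hG hP hQ hR2

end Summit.HubbardSuperconductivity.HubbardSuperconductivity.Theorems.TwoVolumeSource

end
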